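import Mathlib
import HarnessLib

/-!
# `JunctionDefectGrading` — kernel: a two-exponent Fekete bootstrap with a sharp threshold (pure sequence analysis)
# (cell `decomp-a2c`, lens-1 «grading / quantitative ladder», gen 56; file 1 of 2 of the node «JunctionDefectGrading», split per critic row 708 (b))

No chain objects here: real sequences `r : ℕ → ℝ` only.  File 2 (`…SubdiffusiveBondHeatJunctionDefectGrading`) instantiates `r_N := 1/E_N`
(`E_N` = the tree's boundary escape deficit `EscapeGrading.escapeDeficit`) and derives `BondHeatUncertainty.BoundedResponse` (11071) from the
graded pieces `DoublingLaw θ` / `JunctionLaw θ` and `EscapeGrading.ExponentFloor s`, `0 ≤ θ < s ≤ 1`.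

## The kernel (PROVED, 0 sorry): a two-exponent Fekete bootstrap with a sharp threshold, near-diagonal form
`linear_of_doubling_of_floor` (pure real analysis): a real sequence with the DOUBLING inequalities (pairs `M = N`, `M = N + 1` only) of defect
exponent `θ ≥ 0` AND a power floor `c·N^s ≤ r_N` with `s > θ` (`s ≤ 1`) grows LINEARLY, `a·N ≤ r_N` (`linear_of_superadditive_of_floor` = the
all-pairs corollary).  Mechanism: binary Fekete WITH GAIN — splitting `N = u + v`, `u = ⌊N/2⌋` (so `v ∈ {u, u+1}`: only near-diagonal pairs are
ever used), both parts `≤ 2N/3`, gives `u^θ + v^θ ≥ (3/2)^{1−θ}·N^θ` (`rpow_split_gain`), so the inductive minorant `a·N + B·N^θ` with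
`B = C/((3/2)^{1−θ} − 1)` absorbs the defect exactly; the floor with the LARGER exponent seeds the induction on the window `[N₀, 2N₀)`.
Hence `DoublingLaw θ → ExponentFloor s → OhmicFloor → BoundedResponse` for `0 ≤ θ < s ≤ 1` (`ohmicFloor_of_doublingLaw_of_exponentFloor`,
`boundedResponse_of_doublingLaw_of_exponentFloor`) and the `JunctionLaw` versions (`…_of_junctionLaw_of_exponentFloor`; instance `(1/2, 2/3)`).
SHARP BOTH WAYS: `threshold_sharp` — `r_N = N^θ` (`0 ≤ θ < 1`) obeys the junction law with exponent `θ` (`C = 1`) and the floor with `s = θ` and is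
NOT linearly growing (`s > θ` cannot be weakened to `s ≥ θ`); `evenDoubling_not_sufficient` — `w_s(2^k·m) = 2^k·m^s` has EXACT even doubling,
the floor `N^s` and no linear lower bound (the odd pairs `M = N + 1` cannot be dropped; graded twin of the tree's
`dyadicDoubling_subadditive_not_sufficient` / `twoSidedDoubling_not_sufficient` for 11748).  INDEPENDENCE (`junction_of_bounded`).  So:
  11071 ⟸ D(θ) ∧ F(s) ⟸ J(θ) ∧ F(s)  for every `0 ≤ θ < s ≤ 1`, every piece strictly WEAKER than its booked endpoint (11748, resp. 11071)
  when `0 < θ`, `s < 1`; the residual is PRICED by two measurable exponents (below); one EQUIV layer (`OhmicFloor`).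
-/

noncomputable section

open Set

namespace Summit.AtomisticToContinuum.FouriersLaw.Theorems.SubdiffusiveBondHeat

namespace JunctionDefectGrading

/-! ## A. The kernel at sequence level (pure real analysis; no chain objects) -/

/-- **Gain of one split.** For `0 < x ≤ 2n/3` and `θ ≤ 1`: `(2/3)^{θ−1}·n^{θ−1}·x ≤ x^θ`
(`x^θ = x^{θ−1}·x` and `y ↦ y^{θ−1}` is antitone). [folklore] -/
theorem rpow_split_gain {θ x n : ℝ} (hθ1 : θ ≤ 1) (hx : 0 < x) (hxn : x ≤ 2 / 3 * n) :
    (2 / 3 : ℝ) ^ (θ - 1) * n ^ (θ - 1) * x ≤ x ^ θ := by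
  have hn : 0 ≤ n := by linarith
  have hsplit : x ^ θ = x ^ (θ - 1) * x := by
    have h := Real.rpow_add_one hx.ne' (θ - 1)
    rw [sub_add_cancel] at h
    exact h
  have hanti : (2 / 3 * n) ^ (θ - 1) ≤ x ^ (θ - 1) :=
    Real.rpow_le_rpow_of_nonpos hx hxn (by linarith)
  have hmul : (2 / 3 * n) ^ (θ - 1) = (2 / 3 : ℝ) ^ (θ - 1) * n ^ (θ - 1) :=
    Real.mul_rpow (by norm_num) hn
  rw [hsplit, ← hmul]
  exact mul_le_mul_of_nonneg_right hanti hx.le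

/-- **THE KERNEL — two-exponent Fekete bootstrap, NEAR-DIAGONAL form.**  A real sequence obeying the DOUBLING inequalities
`r_N + r_M − C·(N+M)^θ ≤ r_{N+M}` only for the near-diagonal pairs `M = N` and `M = N + 1` (`θ ≥ 0`, `N ≥ 2`) and a power floor
`c·N^s ≤ r_N` (eventually) with `s > θ`, `s ≤ 1`, grows linearly: `a·N ≤ r_N` eventually, some `a > 0`.  Binary splitting
`N = ⌊N/2⌋ + ⌈N/2⌉` (the two parts differ by at most one — this is why only the near-diagonal pairs are ever used) with the gain
`(3/2)^{1−θ} > 1` of `rpow_split_gain`; inductive minorant `a·N + B·N^θ`, `B = C/((3/2)^{1−θ} − 1)`; the floor seeds the window `[N₀, 2N₀)`.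
Sharp in BOTH directions: `threshold_sharp` (`s = θ` fails) and `evenDoubling_not_sufficient` (the odd pairs `M = N + 1` cannot be dropped). [kernel] -/
theorem linear_of_doubling_of_floor {r : ℕ → ℝ} {θ s C c : ℝ} {N₁ : ℕ}
    (hθ : 0 ≤ θ) (hθs : θ < s) (hs : s ≤ 1) (hC : 0 ≤ C) (hc : 0 < c)
    (hJ : ∀ N M : ℕ, 2 ≤ N → (M = N ∨ M = N + 1) → r N + r M - C * ((N : ℝ) + M) ^ θ ≤ r (N + M))
    (hF : ∀ N : ℕ, N₁ ≤ N → c * (N : ℝ) ^ s ≤ r N) :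
    ∃ a : ℝ, 0 < a ∧ ∃ N₀ : ℕ, ∀ N : ℕ, N₀ ≤ N → a * (N : ℝ) ≤ r N := by
  have hθ1 : θ ≤ 1 := le_trans hθs.le hs
  have hc0 : c ≠ 0 := hc.ne'
  -- (1) the gain `g = (2/3)^{θ−1} > 1` of one split and the absorbed defect budget `B = C/(g−1)`
  obtain ⟨g, hg⟩ : ∃ g : ℝ, g = (2 / 3 : ℝ) ^ (θ - 1) := ⟨_, rfl⟩
  have hg1 : 1 < g := by
    rw [hg, Real.one_lt_rpow_iff_of_pos (by norm_num : (0 : ℝ) < 2 / 3)]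
    exact Or.inr ⟨by norm_num, by linarith⟩
  have hg1' : 0 < g - 1 := by linarith
  obtain ⟨B, hB⟩ : ∃ B : ℝ, B = C / (g - 1) := ⟨_, rfl⟩
  have hB0 : 0 ≤ B := by rw [hB]; exact div_nonneg hC hg1'.le
  have hBg : B * (g - 1) = C := by rw [hB]; exact div_mul_cancel₀ C hg1'.ne'
  -- (2) the seed scale `N₀ ≥ N₁, 2` with `K := 2B/c ≤ N₀^{s−θ}`
  have hsθ : 0 < s - θ := by linarith
  obtain ⟨K, hK⟩ : ∃ K : ℝ, K = 2 * B / c := ⟨_, rfl⟩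
  have hK0 : 0 ≤ K := by rw [hK]; positivity
  have hBK : B = c / 2 * K := by
    rw [hK]
    field_simp
  obtain ⟨N₂, hN₂⟩ := exists_nat_ge (K ^ (1 / (s - θ)))
  obtain ⟨N₀, hN₀⟩ : ∃ N₀ : ℕ, N₀ = max N₂ (max N₁ 2) := ⟨_, rfl⟩
  have hN₀2 : 2 ≤ N₀ := by rw [hN₀]; exact le_trans (le_max_right N₁ 2) (le_max_right _ _)
  have hN₀1 : N₁ ≤ N₀ := by rw [hN₀]; exact le_trans (le_max_left N₁ 2) (le_max_right _ _)
  have hN₀N₂ : N₂ ≤ N₀ := by rw [hN₀]; exact le_max_left _ _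
  have hN₀pos : (0 : ℝ) < N₀ := by exact_mod_cast lt_of_lt_of_le (by norm_num) hN₀2
  have hN₀ne : (N₀ : ℝ) ≠ 0 := hN₀pos.ne'
  have hN₀K : K ≤ (N₀ : ℝ) ^ (s - θ) := by
    have h1 : K ^ (1 / (s - θ)) ≤ (N₀ : ℝ) := le_trans hN₂ (by exact_mod_cast hN₀N₂)
    have h2 : (K ^ (1 / (s - θ))) ^ (s - θ) ≤ (N₀ : ℝ) ^ (s - θ) :=
      Real.rpow_le_rpow (Real.rpow_nonneg hK0 _) h1 hsθ.le
    have h3 : (K ^ (1 / (s - θ))) ^ (s - θ) = K := by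
      rw [← Real.rpow_mul hK0, one_div_mul_cancel hsθ.ne', Real.rpow_one]
    rw [h3] at h2
    exact h2
  -- (3) the linear rate
  obtain ⟨a, ha⟩ : ∃ a : ℝ, a = c * (N₀ : ℝ) ^ s / (4 * N₀) := ⟨_, rfl⟩
  have ha0 : 0 < a := by rw [ha]; positivity
  have ha2 : a * (2 * N₀) = c / 2 * (N₀ : ℝ) ^ s := by
    rw [ha]
    field_simp
    ring
  -- (4) the inductive minorant `a·N + B·N^θ ≤ r_N` for `N ≥ N₀`
  have key : ∀ N : ℕ, N₀ ≤ N → a * N + B * (N : ℝ) ^ θ ≤ r N := by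
    intro N
    refine Nat.strong_induction_on N fun N ih => ?_
    intro hN
    have hNpos : (0 : ℝ) < N := by exact_mod_cast lt_of_lt_of_le (by norm_num) (le_trans hN₀2 hN)
    have hNθ0 : 0 ≤ (N : ℝ) ^ θ := Real.rpow_nonneg hNpos.le θ
    -- the defect budget fits under half the floor: `B·N^θ ≤ (c/2)·N^s`
    have hBN : B * (N : ℝ) ^ θ ≤ c / 2 * (N : ℝ) ^ s := by
      have hsplit : (N : ℝ) ^ s = (N : ℝ) ^ (s - θ) * (N : ℝ) ^ θ := by
        rw [← Real.rpow_add hNpos]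
        congr 1
        ring
      have hmono : (N₀ : ℝ) ^ (s - θ) ≤ (N : ℝ) ^ (s - θ) :=
        Real.rpow_le_rpow hN₀pos.le (by exact_mod_cast hN) hsθ.le
      have hKN : K * (N : ℝ) ^ θ ≤ (N : ℝ) ^ (s - θ) * (N : ℝ) ^ θ :=
        mul_le_mul_of_nonneg_right (le_trans hN₀K hmono) hNθ0
      rw [hsplit, hBK]
      calc c / 2 * K * (N : ℝ) ^ θ = c / 2 * (K * (N : ℝ) ^ θ) := by ring
        _ ≤ c / 2 * ((N : ℝ) ^ (s - θ) * (N : ℝ) ^ θ) := mul_le_mul_of_nonneg_left hKN (by linarith)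
    by_cases hsmall : N < 2 * N₀
    · -- seed window `N₀ ≤ N < 2N₀`: everything from the floor
      have hFN : c * (N : ℝ) ^ s ≤ r N := hF N (le_trans hN₀1 hN)
      have hmono : (N₀ : ℝ) ^ s ≤ (N : ℝ) ^ s :=
        Real.rpow_le_rpow hN₀pos.le (by exact_mod_cast hN) (by linarith)
      have hN2 : (N : ℝ) ≤ 2 * N₀ := by exact_mod_cast hsmall.le
      have haN : a * N ≤ c / 2 * (N : ℝ) ^ s :=
        calc a * N ≤ a * (2 * N₀) := mul_le_mul_of_nonneg_left hN2 ha0.le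
          _ = c / 2 * (N₀ : ℝ) ^ s := ha2
          _ ≤ c / 2 * (N : ℝ) ^ s := mul_le_mul_of_nonneg_left hmono (by linarith)
      linarith
    · -- binary split `N = u + v`, `u = ⌊N/2⌋`: both parts in `[N₀, N)` and `≤ 2N/3`
      push Not at hsmall
      obtain ⟨u, hu⟩ : ∃ u : ℕ, u = N / 2 := ⟨_, rfl⟩
      obtain ⟨v, hv⟩ : ∃ v : ℕ, v = N - N / 2 := ⟨_, rfl⟩
      have huv : u + v = N := by omega
      have hu₀ : N₀ ≤ u := by omega
      have hv₀ : N₀ ≤ v := by omega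
      have huN : u < N := by omega
      have hvN : v < N := by omega
      have hu2 : 2 ≤ u := le_trans hN₀2 hu₀
      have hv2 : 2 ≤ v := le_trans hN₀2 hv₀
      have h2u : 2 * u ≤ N := by omega
      have h2v : 2 * v ≤ N + 1 := by omega
      have hN3 : 3 ≤ N := by omega
      have ihu := ih u huN hu₀
      have ihv := ih v hvN hv₀
      have hJuv := hJ u v hu2 (by omega)
      rw [huv] at hJuv
      have hcast : ((u : ℝ) + (v : ℝ)) = (N : ℝ) := by exact_mod_cast huv
      rw [hcast] at hJuv
      have hupos : (0 : ℝ) < u := by exact_mod_cast lt_of_lt_of_le (by norm_num) hu2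
      have hvpos : (0 : ℝ) < v := by exact_mod_cast lt_of_lt_of_le (by norm_num) hv2
      have hule : (u : ℝ) ≤ 2 / 3 * N := by
        have h1 : 2 * (u : ℝ) ≤ N := by exact_mod_cast h2u
        linarith
      have hvle : (v : ℝ) ≤ 2 / 3 * N := by
        have h1 : 2 * (v : ℝ) ≤ N + 1 := by exact_mod_cast h2v
        have h2 : (3 : ℝ) ≤ N := by exact_mod_cast hN3
        linarith
      have hgu := rpow_split_gain hθ1 hupos hule
      have hgv := rpow_split_gain hθ1 hvpos hvle
      rw [← hg] at hgu hgv
      have hNθ : (N : ℝ) * (N : ℝ) ^ (θ - 1) = (N : ℝ) ^ θ := by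
        have h := Real.rpow_add_one hNpos.ne' (θ - 1)
        rw [sub_add_cancel] at h
        rw [h]
        ring
      have hsum : g * (N : ℝ) ^ θ ≤ (u : ℝ) ^ θ + (v : ℝ) ^ θ := by
        have : g * (N : ℝ) ^ (θ - 1) * u + g * (N : ℝ) ^ (θ - 1) * v = g * (N : ℝ) ^ θ := by
          rw [← hNθ, ← hcast]
          ring
        linarith
      have hBsum : B * (g * (N : ℝ) ^ θ) ≤ B * ((u : ℝ) ^ θ + (v : ℝ) ^ θ) :=
        mul_le_mul_of_nonneg_left hsum hB0
      have hBgN : B * (g * (N : ℝ) ^ θ) = B * (N : ℝ) ^ θ + C * (N : ℝ) ^ θ := by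
        rw [← hBg]
        ring
      have haN : a * N = a * u + a * v := by
        rw [← hcast]
        ring
      linarith [ihu, ihv, hBsum, hBgN, haN, hJuv]
  -- (5) conclusion
  refine ⟨a, ha0, N₀, fun N hN => ?_⟩
  have h := key N hN
  have : 0 ≤ B * (N : ℝ) ^ θ := mul_nonneg hB0 (Real.rpow_nonneg (Nat.cast_nonneg N) θ)
  linarith

/-- The kernel with the full two-argument hypothesis (all `N, M ≥ 2`): immediate from the near-diagonal form. [kernel] -/
theorem linear_of_superadditive_of_floor {r : ℕ → ℝ} {θ s C c : ℝ} {N₁ : ℕ}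
    (hθ : 0 ≤ θ) (hθs : θ < s) (hs : s ≤ 1) (hC : 0 ≤ C) (hc : 0 < c)
    (hJ : ∀ N M : ℕ, 2 ≤ N → 2 ≤ M → r N + r M - C * ((N : ℝ) + M) ^ θ ≤ r (N + M))
    (hF : ∀ N : ℕ, N₁ ≤ N → c * (N : ℝ) ^ s ≤ r N) :
    ∃ a : ℝ, 0 < a ∧ ∃ N₀ : ℕ, ∀ N : ℕ, N₀ ≤ N → a * (N : ℝ) ≤ r N :=
  linear_of_doubling_of_floor hθ hθs hs hC hc (fun N M hN hM => hJ N M hN (by omega)) hF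

/-- **SHARPNESS of the threshold `s > θ`.**  For `0 ≤ θ < 1` the sequence `r_N = N^θ` obeys the junction law with defect exponent `θ`
(`C = 1`) and the power floor with exponent `s = θ` (`c = 1`, all `N`), and is NOT eventually linearly bounded below.  So in
`linear_of_superadditive_of_floor` the floor exponent must beat the defect exponent strictly. [kernel · sharpness] -/
theorem threshold_sharp {θ : ℝ} (hθ : 0 ≤ θ) (hθ1 : θ < 1) :
    ∃ r : ℕ → ℝ,
      (∀ N M : ℕ, 2 ≤ N → 2 ≤ M → r N + r M - 1 * ((N : ℝ) + M) ^ θ ≤ r (N + M)) ∧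
      (∀ N : ℕ, 0 ≤ N → 1 * (N : ℝ) ^ θ ≤ r N) ∧
      ¬ ∃ a : ℝ, 0 < a ∧ ∃ N₀ : ℕ, ∀ N : ℕ, N₀ ≤ N → a * (N : ℝ) ≤ r N := by
  refine ⟨fun N => (N : ℝ) ^ θ, ?_, fun N _ => by simp, ?_⟩
  · intro N M hN hM
    have hN0 : (0 : ℝ) ≤ N := Nat.cast_nonneg N
    have hM0 : (0 : ℝ) ≤ M := Nat.cast_nonneg M
    have h1 : (N : ℝ) ^ θ ≤ ((N : ℝ) + M) ^ θ := Real.rpow_le_rpow hN0 (by linarith) hθ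
    have h2 : (M : ℝ) ^ θ ≤ ((N : ℝ) + M) ^ θ := Real.rpow_le_rpow hM0 (by linarith) hθ
    have hc : (((N + M : ℕ) : ℝ)) ^ θ = ((N : ℝ) + M) ^ θ := by push_cast; ring_nf
    show (N : ℝ) ^ θ + (M : ℝ) ^ θ - 1 * ((N : ℝ) + M) ^ θ ≤ (((N + M : ℕ) : ℝ)) ^ θ
    rw [hc]
    linarith
  · rintro ⟨a, ha, N₀, h⟩
    have hθ1' : θ - 1 < 0 := by linarith
    obtain ⟨N, hN⟩ := exists_nat_gt (max (N₀ : ℝ) (a ^ (1 / (θ - 1))))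
    have hNN₀ : N₀ ≤ N := by exact_mod_cast (le_trans (le_max_left _ _) hN.le)
    have hx : 0 < a ^ (1 / (θ - 1)) := Real.rpow_pos_of_pos ha _
    have hxN : a ^ (1 / (θ - 1)) < (N : ℝ) := lt_of_le_of_lt (le_max_right _ _) hN
    have hNpos : (0 : ℝ) < N := lt_trans hx hxN
    have hlt : (N : ℝ) ^ (θ - 1) < (a ^ (1 / (θ - 1))) ^ (θ - 1) :=
      Real.rpow_lt_rpow_of_neg hx hxN hθ1'
    have ha' : (a ^ (1 / (θ - 1))) ^ (θ - 1) = a := by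
      rw [← Real.rpow_mul ha.le, one_div_mul_cancel hθ1'.ne, Real.rpow_one]
    rw [ha'] at hlt
    have hmain : a * (N : ℝ) ≤ (N : ℝ) ^ θ := h N hNN₀
    have hsplit : (N : ℝ) ^ θ = (N : ℝ) ^ (θ - 1) * N := by
      have h' := Real.rpow_add_one hNpos.ne' (θ - 1)
      rw [sub_add_cancel] at h'
      exact h'
    rw [hsplit] at hmain
    have : (N : ℝ) ^ (θ - 1) * N < a * N := mul_lt_mul_of_pos_right hlt hNpos
    linarith

/-- Auxiliary witness for `evenDoubling_not_sufficient`: `w_s(N) = 2·w_s(N/2)` for even `N ≥ 2`, `w_s(N) = N^s` otherwise — i.e.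
`w_s(2^k·m) = 2^k·m^s` for odd `m`. [kernel · sharpness] -/
noncomputable def evenWitness (s : ℝ) (N : ℕ) : ℝ :=
  if h : 2 ≤ N ∧ N % 2 = 0 then 2 * evenWitness s (N / 2) else (N : ℝ) ^ s
termination_by N
decreasing_by omega

/-- Exact even doubling of the witness. [kernel · sharpness] -/
theorem evenWitness_two_mul (s : ℝ) {N : ℕ} (hN : 1 ≤ N) : evenWitness s (2 * N) = 2 * evenWitness s N := by
  rw [evenWitness, dif_pos (by omega)]
  have h : 2 * N / 2 = N := by omega
  rw [h]

/-- The witness at odd arguments. [kernel · sharpness] -/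
theorem evenWitness_of_odd (s : ℝ) {N : ℕ} (hN : N % 2 = 1) : evenWitness s N = (N : ℝ) ^ s := by
  rw [evenWitness, dif_neg (by omega)]

/-- The witness dominates the power floor `N^s` (`s ≤ 1`; uses `2^s ≤ 2`). [kernel · sharpness] -/
theorem rpow_le_evenWitness {s : ℝ} (hs1 : s ≤ 1) : ∀ N : ℕ, (N : ℝ) ^ s ≤ evenWitness s N := by
  intro N
  induction N using Nat.strong_induction_on with
  | _ N ih =>
    by_cases h : 2 ≤ N ∧ N % 2 = 0
    · rw [evenWitness, dif_pos h]
      obtain ⟨m, hm⟩ : ∃ m : ℕ, N = 2 * m := ⟨N / 2, by omega⟩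
      have hdiv : N / 2 = m := by omega
      rw [hdiv]
      have ihm := ih m (by omega)
      have hm0 : (0 : ℝ) ≤ m := Nat.cast_nonneg m
      have hcast : (N : ℝ) = 2 * m := by rw [hm]; push_cast; ring
      rw [hcast, Real.mul_rpow (by norm_num) hm0]
      have h2s : (2 : ℝ) ^ s ≤ 2 := by
        have h2 := Real.rpow_le_rpow_of_exponent_le (by norm_num : (1 : ℝ) ≤ 2) hs1
        rwa [Real.rpow_one] at h2
      have hms : 0 ≤ (m : ℝ) ^ s := Real.rpow_nonneg hm0 s
      nlinarith
    · rw [evenWitness, dif_neg h]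

/-- **SHARPNESS in the other direction: the odd pairs are load-bearing.**  For every `s < 1` the sequence `w_s` has EXACT even
doubling `w_s(2N) = 2·w_s(N)` (so the even half `M = N` of every doubling law holds with defect `0`), the power floor `N^s ≤ w_s(N)`
for all `N`, positivity, and yet NO linear lower bound (`w_s(N) = N^s` at odd `N`).  Hence `linear_of_doubling_of_floor` cannot be
thinned to even doubling `M = N` alone — the graded analogue of the tree's `twoSidedDoubling_not_sufficient` /
`dyadicDoubling_subadditive_not_sufficient` for the 11748 line. [kernel · sharpness] -/
theorem evenDoubling_not_sufficient {s : ℝ} (hs1 : s < 1) :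
    ∃ r : ℕ → ℝ,
      (∀ N : ℕ, 1 ≤ N → 0 < r N) ∧
      (∀ N : ℕ, 1 ≤ N → r (2 * N) = 2 * r N) ∧
      (∀ N : ℕ, (N : ℝ) ^ s ≤ r N) ∧
      ¬ ∃ a : ℝ, 0 < a ∧ ∃ N₀ : ℕ, ∀ N : ℕ, N₀ ≤ N → a * (N : ℝ) ≤ r N := by
  refine ⟨evenWitness s, ?_, fun N hN => evenWitness_two_mul s hN, rpow_le_evenWitness hs1.le, ?_⟩
  · intro N hN
    have hpos : (0 : ℝ) < (N : ℝ) ^ s := Real.rpow_pos_of_pos (by exact_mod_cast hN) s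
    exact lt_of_lt_of_le hpos (rpow_le_evenWitness hs1.le N)
  · rintro ⟨a, ha, N₀, h⟩
    have hs1' : s - 1 < 0 := by linarith
    obtain ⟨n, hn⟩ := exists_nat_gt (max (N₀ : ℝ) (a ^ (1 / (s - 1))))
    -- the odd length `M = 2n + 1` exceeds both `N₀` and `a^{1/(s−1)}`
    obtain ⟨M, hM⟩ : ∃ M : ℕ, M = 2 * n + 1 := ⟨_, rfl⟩
    have hModd : M % 2 = 1 := by omega
    have hnM : (n : ℝ) ≤ (M : ℝ) := by exact_mod_cast (show n ≤ M by omega)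
    have hMgt : max (N₀ : ℝ) (a ^ (1 / (s - 1))) < (M : ℝ) := lt_of_lt_of_le hn hnM
    have hMN₀ : N₀ ≤ M := by exact_mod_cast (le_trans (le_max_left _ _) hMgt.le)
    have hx : 0 < a ^ (1 / (s - 1)) := Real.rpow_pos_of_pos ha _
    have hxM : a ^ (1 / (s - 1)) < (M : ℝ) := lt_of_le_of_lt (le_max_right _ _) hMgt
    have hMpos : (0 : ℝ) < M := lt_trans hx hxM
    have hlt : (M : ℝ) ^ (s - 1) < (a ^ (1 / (s - 1))) ^ (s - 1) := Real.rpow_lt_rpow_of_neg hx hxM hs1'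
    have ha' : (a ^ (1 / (s - 1))) ^ (s - 1) = a := by
      rw [← Real.rpow_mul ha.le, one_div_mul_cancel hs1'.ne, Real.rpow_one]
    rw [ha'] at hlt
    have hmain : a * (M : ℝ) ≤ evenWitness s M := h M hMN₀
    rw [evenWitness_of_odd s hModd] at hmain
    have hsplit : (M : ℝ) ^ s = (M : ℝ) ^ (s - 1) * M := by
      have h' := Real.rpow_add_one hMpos.ne' (s - 1)
      rw [sub_add_cancel] at h'
      exact h'
    rw [hsplit] at hmain
    have : (M : ℝ) ^ (s - 1) * M < a * M := mul_lt_mul_of_pos_right hlt hMpos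
    linarith

/-- **INDEPENDENCE: the junction law alone has no Fourier content.**  Every bounded nonnegative sequence obeys the junction law with
ANY exponent `θ ≥ 0` (defect constant `2·sup r`).  Calibration: at `lam = β = 0` the escape deficits converge to `E_∞ > 0`
(Rieder–Lebowitz–Lieb flat profile, `D_N = (N−1)·fluxCoeff`), so `r_N = 1/E_N` is bounded and every `J(θ)` holds while the Ohmic floor
fails — it is the PAIR (junction law, escape floor) that carries 11071, never `J(θ)` by itself. [kernel · independence] -/
theorem junction_of_bounded {r : ℕ → ℝ} {R θ : ℝ} (hθ : 0 ≤ θ) (h0 : ∀ N, 0 ≤ r N) (hR : ∀ N, r N ≤ R) :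
    ∀ N M : ℕ, 2 ≤ N → 2 ≤ M → r N + r M - (2 * R) * ((N : ℝ) + M) ^ θ ≤ r (N + M) := by
  intro N M hN hM
  have hR0 : 0 ≤ R := le_trans (h0 0) (hR 0)
  have h1 : (1 : ℝ) ≤ ((N : ℝ) + M) ^ θ := by
    apply Real.one_le_rpow _ hθ
    have : (2 : ℝ) ≤ N := by exact_mod_cast hN
    have : (2 : ℝ) ≤ M := by exact_mod_cast hM
    linarith
  have h2 : 2 * R * 1 ≤ 2 * R * ((N : ℝ) + M) ^ θ := mul_le_mul_of_nonneg_left h1 (by linarith)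
  linarith [hR N, hR M, h0 (N + M)]

end JunctionDefectGrading

end Summit.AtomisticToContinuum.FouriersLaw.Theorems.SubdiffusiveBondHeat

end
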